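import Mathlib
import Summits.ValiantsHypothesis.ValiantsHypothesis.Theorems.NewtonUnitEquationsTwoProductsMinkowskiSW
import Summits.ValiantsHypothesis.ValiantsHypothesis.Theorems.NewtonUnitEquationsTwoProductsSeparated

/-! # Stub `stub_engineTaggedCores` — crux `TwoProducts` (stmt-ValiantsHypothesis-5906), line `corner-log-linearization`

TAGGED CORES.  Factors `u_i = s_i + τ_i`, `v_i = s'_i + τ_i` with `x`-axis cores `s_i, s'_i` and a SHARED tag part
`τ_i = Σ_{b ∈ T_i} c_i(b) x^b` with dissociated ordinates (the ordinate of `Σ_{i∈I} κ_i`, `κ_i ∈ T_i`, determines `I`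
and `κ|_I`): `D = ∏ u_i − ∏ v_i` has at most `2^n (Σ_i |T_i| + 1)` south-west vertices.
EXPANSION over option patterns `x` (`none` = core, `some b` = tag letter): `D = Σ_x C(c_x) X^{b_x} (S_x − S'_x)` with
`S_x − S'_x` on the `x`-axis (`coeff_diff`), so the piece `x` lives on the row `y = (b_x) 1` and distinct pieces live on
distinct rows (`eq_of_row_eq`); every support point has, weakly to its left on its row, the LEADER `b_x + (o_J, 0)` of its
piece (`exists_piece`, `add_mem_support`; `o_J` = least abscissa of the core part of the pattern `J = {i : x i ≠ none}`).
COUNT: a south-west vertex is a leader and stays a strict minimiser over the leader set `(Σ_{i∈J} T*_i) + (o_J, 0)` of its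
pattern (`sv_subset_iUnion`); iterating the Minkowski brick `stub_minkowskiSW` over `J` bounds the vertices of that
sumset by `Σ_{i∈J} |T_i| + 1` (`sv_leaders_le`); sum over the `2^n` patterns. [folklore] -/

set_option linter.dupNamespace false -- single-conjunct summit: `ValiantsHypothesis.ValiantsHypothesis`

namespace Summit.ValiantsHypothesis.ValiantsHypothesis.Theorems.TwoProducts.TaggedCores

open scoped BigOperators
open MvPolynomial
open Summit.ValiantsHypothesis.ValiantsHypothesis.Theorems.TwoProducts.MinkowskiSW (stub_minkowskiSW)
open Summit.ValiantsHypothesis.ValiantsHypothesis.Theorems.TwoProducts.Separated (prod_support_apply_eq_zero)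

/-! ## Expansion of the products over option patterns -/

/-- One expanded term: choosing the core (`none`) or a tag letter (`some b`) in every factor gives
`C(∏ c) · X^{Σ b} · ∏ (cores)`. [folklore] -/
theorem prod_option_elim {n : ℕ} (s : Fin n → MvPolynomial (Fin 2) ℂ) (c : Fin n → (Fin 2 →₀ ℕ) → ℂ)
    (x : Fin n → Option (Fin 2 →₀ ℕ)) :
    ∏ i, (x i).elim (s i) (fun b => C (c i b) * monomial b 1) =
      C (∏ i, (x i).elim 1 (c i)) * monomial (∑ i, (x i).elim 0 id) 1 *
        ∏ i, (x i).elim (s i) (fun _ => 1) := by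
  rw [map_prod, monomial_sum_one, ← Finset.prod_mul_distrib, ← Finset.prod_mul_distrib]
  refine Finset.prod_congr rfl fun i _ => ?_
  cases x i <;> simp

/-- EXPANSION: `∏ (s_i + Σ_{b∈T_i} c_i(b) X^b) = Σ_x C(c_x) X^{b_x} S_x` over the option patterns
`x ∈ Π_i ({none} ∪ T_i)`. [folklore] -/
theorem prod_expand {n : ℕ} (s : Fin n → MvPolynomial (Fin 2) ℂ) (T : Fin n → Finset (Fin 2 →₀ ℕ))
    (c : Fin n → (Fin 2 →₀ ℕ) → ℂ) :
    ∏ i, (s i + ∑ b ∈ T i, C (c i b) * monomial b 1) =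
      ∑ x ∈ Fintype.piFinset (fun i => Finset.insertNone (T i)),
        C (∏ i, (x i).elim 1 (c i)) * monomial (∑ i, (x i).elim 0 id) 1 *
          ∏ i, (x i).elim (s i) (fun _ => 1) := by
  calc ∏ i, (s i + ∑ b ∈ T i, C (c i b) * monomial b 1)
      = ∏ i, ∑ o ∈ Finset.insertNone (T i), o.elim (s i) (fun b => C (c i b) * monomial b 1) := by
        refine Finset.prod_congr rfl fun i _ => ?_
        simp only [Finset.sum_insertNone, Option.elim]
    _ = _ := by
        rw [Finset.prod_univ_sum]
        exact Finset.sum_congr rfl fun x _ => prod_option_elim s c x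

/-- COEFFICIENTS OF `D`: `[q] D = Σ_x c_x · [q − b_x](S_x − S'_x)` (the term is absent unless `b_x ≤ q`).
[folklore] -/
theorem coeff_diff {n : ℕ} (s s' : Fin n → MvPolynomial (Fin 2) ℂ) (T : Fin n → Finset (Fin 2 →₀ ℕ))
    (c : Fin n → (Fin 2 →₀ ℕ) → ℂ) (q : Fin 2 →₀ ℕ) :
    coeff q ((∏ i, (s i + ∑ b ∈ T i, C (c i b) * monomial b 1)) -
        ∏ i, (s' i + ∑ b ∈ T i, C (c i b) * monomial b 1)) =
      ∑ x ∈ Fintype.piFinset (fun i => Finset.insertNone (T i)),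
        (∏ i, (x i).elim 1 (c i)) *
          if ∑ i, (x i).elim 0 id ≤ q then
            coeff (q - ∑ i, (x i).elim 0 id)
              ((∏ i, (x i).elim (s i) (fun _ => 1)) - ∏ i, (x i).elim (s' i) (fun _ => 1))
          else 0 := by
  rw [prod_expand, prod_expand, ← Finset.sum_sub_distrib, coeff_sum]
  refine Finset.sum_congr rfl fun x _ => ?_
  rw [← mul_sub, mul_assoc, coeff_C_mul, coeff_monomial_mul', one_mul]

/-- The core part `S_x − S'_x` of a piece lives on the `x`-axis. [folklore] -/
theorem core_support {n : ℕ} (s s' : Fin n → MvPolynomial (Fin 2) ℂ)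
    (hs : ∀ i, ∀ q ∈ (s i).support, q 1 = 0) (hs' : ∀ i, ∀ q ∈ (s' i).support, q 1 = 0)
    (x : Fin n → Option (Fin 2 →₀ ℕ)) :
    ∀ q ∈ ((∏ i, (x i).elim (s i) (fun _ => 1)) - ∏ i, (x i).elim (s' i) (fun _ => 1)).support,
      q 1 = 0 := by
  classical
  have key : ∀ t : Fin n → MvPolynomial (Fin 2) ℂ, (∀ i, ∀ q ∈ (t i).support, q 1 = 0) →
      ∀ q ∈ (∏ i, (x i).elim (t i) (fun _ => 1)).support, q 1 = 0 := by
    intro t ht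
    refine prod_support_apply_eq_zero 1 Finset.univ _ fun i _ => ?_
    cases x i with
    | none => exact ht i
    | some b =>
      intro q hq
      change q ∈ (1 : MvPolynomial (Fin 2) ℂ).support at hq
      rw [MvPolynomial.support_one, Finset.mem_singleton] at hq
      simp [hq]
  intro q hq
  rcases Finset.mem_union.mp (MvPolynomial.support_sub _ _ _ hq) with h | h
  exacts [key s hs q h, key s' hs' q h]

/-- The core part of a piece depends only on its pattern `J = {i : x i ≠ none}`. [folklore] -/
theorem core_eq {n : ℕ} (t : Fin n → MvPolynomial (Fin 2) ℂ) (x : Fin n → Option (Fin 2 →₀ ℕ))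
    (J : Finset (Fin n)) (hJ : (Finset.univ.filter fun i => (x i).isSome) = J) :
    ∏ i, (x i).elim (t i) (fun _ => 1) = ∏ i, if i ∈ J then 1 else t i := by
  refine Finset.prod_congr rfl fun i _ => ?_
  have hi : i ∈ J ↔ (x i).isSome := by rw [← hJ]; simp
  revert hi; cases x i <;> intro hi <;> simp at hi <;> simp [hi]

/-! ## Rows: dissociation separates the pieces -/

/-- DISSOCIATION FOR PATTERNS: two option patterns whose tag sums have the same ordinate coincide. [folklore] -/
theorem eq_of_row_eq {n : ℕ} (T : Fin n → Finset (Fin 2 →₀ ℕ))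
    (hd : ∀ (I I' : Finset (Fin n)) (κ κ' : Fin n → (Fin 2 →₀ ℕ)), (∀ i ∈ I, κ i ∈ T i) →
      (∀ i ∈ I', κ' i ∈ T i) → ∑ i ∈ I, (κ i) 1 = ∑ i ∈ I', (κ' i) 1 → I = I' ∧ ∀ i ∈ I, κ i = κ' i)
    {x x' : Fin n → Option (Fin 2 →₀ ℕ)} (hx : x ∈ Fintype.piFinset fun i => Finset.insertNone (T i))
    (hx' : x' ∈ Fintype.piFinset fun i => Finset.insertNone (T i))
    (h : (∑ i, (x i).elim 0 id) 1 = (∑ i, (x' i).elim 0 id) 1) : x = x' := by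
  have hT : ∀ y : Fin n → Option (Fin 2 →₀ ℕ), y ∈ Fintype.piFinset (fun i => Finset.insertNone (T i)) →
      ∀ i ∈ Finset.univ.filter (fun i => (y i).isSome), (y i).elim 0 id ∈ T i := by
    intro y hy i hi
    have hyi := Fintype.mem_piFinset.mp hy i
    simp only [Finset.mem_filter, Finset.mem_univ, true_and] at hi
    revert hi hyi; cases y i <;> simp
  have hsum : ∀ y : Fin n → Option (Fin 2 →₀ ℕ),
      ∑ i ∈ Finset.univ.filter (fun i => (y i).isSome), ((y i).elim 0 id) 1 = (∑ i, (y i).elim 0 id) 1 := by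
    intro y
    rw [Finsupp.finsetSum_apply, Finset.sum_filter_of_ne]
    intro i _ hne; revert hne; cases y i <;> simp
  obtain ⟨hI, hκ⟩ := hd _ _ (fun i => (x i).elim 0 id) (fun i => (x' i).elim 0 id) (hT x hx) (hT x' hx')
    (by rw [hsum x, hsum x']; exact h)
  funext i
  have h1 := Finset.ext_iff.mp hI i
  have h2 := hκ i
  simp only [Finset.mem_filter, Finset.mem_univ, true_and] at h1 h2
  revert h1 h2; cases x i <;> cases x' i <;> simp

/-- ROW STRUCTURE: a support point `q` of `D` is seen by a piece `x` with `c_x ≠ 0`: `q = b_x + p` with `p` in the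
support of the core part `S_x − S'_x`. [folklore] -/
theorem exists_piece {n : ℕ} (s s' : Fin n → MvPolynomial (Fin 2) ℂ) (T : Fin n → Finset (Fin 2 →₀ ℕ))
    (c : Fin n → (Fin 2 →₀ ℕ) → ℂ) {q : Fin 2 →₀ ℕ}
    (hq : q ∈ ((∏ i, (s i + ∑ b ∈ T i, C (c i b) * monomial b 1)) -
        ∏ i, (s' i + ∑ b ∈ T i, C (c i b) * monomial b 1)).support) :
    ∃ x ∈ Fintype.piFinset (fun i => Finset.insertNone (T i)), ∏ i, (x i).elim 1 (c i) ≠ 0 ∧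
      ∑ i, (x i).elim 0 id ≤ q ∧
      q - ∑ i, (x i).elim 0 id ∈
        ((∏ i, (x i).elim (s i) (fun _ => 1)) - ∏ i, (x i).elim (s' i) (fun _ => 1)).support := by
  classical
  rw [mem_support_iff, coeff_diff] at hq
  obtain ⟨x, hx, hne⟩ := Finset.exists_ne_zero_of_sum_ne_zero hq
  refine ⟨x, hx, left_ne_zero_of_mul hne, ?_⟩
  have h := right_ne_zero_of_mul hne
  split_ifs at h with hle
  exacts [⟨hle, mem_support_iff.mpr h⟩, absurd rfl h]

/-- ALIVE PIECES ARE VISIBLE: if `c_x ≠ 0` and `p` is in the support of `S_x − S'_x`, then `b_x + p ∈ supp D`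
(no other piece lives on that row, by dissociation). [folklore] -/
theorem add_mem_support {n : ℕ} (s s' : Fin n → MvPolynomial (Fin 2) ℂ) (T : Fin n → Finset (Fin 2 →₀ ℕ))
    (c : Fin n → (Fin 2 →₀ ℕ) → ℂ) (hs : ∀ i, ∀ q ∈ (s i).support, q 1 = 0)
    (hs' : ∀ i, ∀ q ∈ (s' i).support, q 1 = 0)
    (hd : ∀ (I I' : Finset (Fin n)) (κ κ' : Fin n → (Fin 2 →₀ ℕ)), (∀ i ∈ I, κ i ∈ T i) →
      (∀ i ∈ I', κ' i ∈ T i) → ∑ i ∈ I, (κ i) 1 = ∑ i ∈ I', (κ' i) 1 → I = I' ∧ ∀ i ∈ I, κ i = κ' i)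
    {x : Fin n → Option (Fin 2 →₀ ℕ)} (hx : x ∈ Fintype.piFinset fun i => Finset.insertNone (T i))
    (hc : ∏ i, (x i).elim 1 (c i) ≠ 0) {r : Fin 2 →₀ ℕ}
    (hr : r ∈ ((∏ i, (x i).elim (s i) (fun _ => 1)) - ∏ i, (x i).elim (s' i) (fun _ => 1)).support) :
    (∑ i, (x i).elim 0 id) + r ∈ ((∏ i, (s i + ∑ b ∈ T i, C (c i b) * monomial b 1)) -
        ∏ i, (s' i + ∑ b ∈ T i, C (c i b) * monomial b 1)).support := by
  classical
  rw [mem_support_iff, coeff_diff, Finset.sum_eq_single_of_mem x hx]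
  · rw [if_pos le_self_add, add_tsub_cancel_left]
    exact mul_ne_zero hc (mem_support_iff.mp hr)
  · intro x' hx' hne
    rw [mul_eq_zero, ite_eq_right_iff]
    refine Or.inr fun hle => ?_
    by_contra h
    refine hne (eq_of_row_eq T hd hx' hx ?_)
    have h1 := core_support s s' hs hs' x' _ (mem_support_iff.mpr h)
    have h2 := core_support s s' hs hs' x r hr
    have h3 := Finsupp.le_def.mp hle 1
    simp only [Finsupp.coe_add, Finsupp.coe_tsub, Pi.add_apply, Pi.sub_apply] at h1 h3
    omega

/-! ## South-west vertices: abstract counting -/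

/-- South-west vertices of `A` are points of `A`. [folklore] -/
theorem sv_ncard_le_card (A : Finset (Fin 2 →₀ ℕ)) :
    {e : Fin 2 →₀ ℕ | ∃ w : Fin 2 → ℤ, 0 < w 0 ∧ 0 < w 1 ∧ e ∈ A ∧
        ∀ e' ∈ A, e' ≠ e → w 0 * (e 0 : ℤ) + w 1 * (e 1 : ℤ) < w 0 * (e' 0 : ℤ) + w 1 * (e' 1 : ℤ)}.ncard ≤
      A.card := by
  rw [← Set.ncard_coe_finset A]
  exact Set.ncard_le_ncard (by rintro e ⟨w, -, -, he, -⟩; exact he) (Finset.finite_toSet A)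

/-- LEADERS CARRY THE VERTICES: if every point of `S` has, on its row and weakly to its left, a point of some leader
set `M j ⊆ S`, then every south-west vertex of `S` is a south-west vertex of some `M j`. [folklore] -/
theorem sv_subset_iUnion {κ : Type*} (S : Finset (Fin 2 →₀ ℕ)) (M : κ → Finset (Fin 2 →₀ ℕ))
    (hMS : ∀ j, M j ⊆ S) (hcov : ∀ e ∈ S, ∃ j, ∃ m ∈ M j, m 1 = e 1 ∧ m 0 ≤ e 0) :
    {e : Fin 2 →₀ ℕ | ∃ w : Fin 2 → ℤ, 0 < w 0 ∧ 0 < w 1 ∧ e ∈ S ∧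
        ∀ e' ∈ S, e' ≠ e → w 0 * (e 0 : ℤ) + w 1 * (e 1 : ℤ) < w 0 * (e' 0 : ℤ) + w 1 * (e' 1 : ℤ)} ⊆
      ⋃ j, {e : Fin 2 →₀ ℕ | ∃ w : Fin 2 → ℤ, 0 < w 0 ∧ 0 < w 1 ∧ e ∈ M j ∧
        ∀ e' ∈ M j, e' ≠ e → w 0 * (e 0 : ℤ) + w 1 * (e 1 : ℤ) < w 0 * (e' 0 : ℤ) + w 1 * (e' 1 : ℤ)} := by
  rintro e ⟨w, hw0, hw1, he, hmin⟩
  obtain ⟨j, m, hm, hm1, hm0⟩ := hcov e he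
  have hme : m = e := by
    by_contra hne
    have hlt := hmin m (hMS j hm) hne
    have h0 : ((m 0 : ℕ) : ℤ) ≤ e 0 := by exact_mod_cast hm0
    have h1 : ((m 1 : ℕ) : ℤ) = e 1 := by exact_mod_cast hm1
    nlinarith [mul_le_mul_of_nonneg_left h0 hw0.le]
  subst hme
  exact Set.mem_iUnion.mpr ⟨j, w, hw0, hw1, hm, fun e' he' hne => hmin e' (hMS j he') hne⟩

open scoped Pointwise in
/-- Membership in an iterated sumset of finsets. [folklore] -/
theorem mem_finsetSum_iff {ι : Type*} (J : Finset ι) (A : ι → Finset (Fin 2 →₀ ℕ)) (b : Fin 2 →₀ ℕ) :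
    b ∈ ∑ i ∈ J, A i ↔ ∃ g : ι → Fin 2 →₀ ℕ, (∀ i ∈ J, g i ∈ A i) ∧ ∑ i ∈ J, g i = b := by
  rw [← Finset.mem_coe, Finset.coe_sum, Set.mem_finsetSum]
  exact ⟨fun ⟨g, hg, hsum⟩ => ⟨g, fun i hi => Finset.mem_coe.mp (hg hi), hsum⟩,
    fun ⟨g, hg, hsum⟩ => ⟨g, fun {i} hi => Finset.mem_coe.mpr (hg i hi), hsum⟩⟩

open scoped Pointwise in
/-- ITERATED MINKOWSKI BRICK: for nonempty `A_i`, `#swVert(Σ_{i∈J} A_i) + |J| ≤ Σ_{i∈J} #swVert(A_i) + 1`.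
[folklore] -/
theorem sv_sum_le {ι : Type*} [DecidableEq ι] (J : Finset ι) (A : ι → Finset (Fin 2 →₀ ℕ))
    (hA : ∀ i ∈ J, (A i).Nonempty) :
    (∑ i ∈ J, A i).Nonempty ∧
      {e : Fin 2 →₀ ℕ | ∃ w : Fin 2 → ℤ, 0 < w 0 ∧ 0 < w 1 ∧ e ∈ ∑ i ∈ J, A i ∧
        ∀ e' ∈ ∑ i ∈ J, A i, e' ≠ e →
          w 0 * (e 0 : ℤ) + w 1 * (e 1 : ℤ) < w 0 * (e' 0 : ℤ) + w 1 * (e' 1 : ℤ)}.ncard + J.card ≤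
      ∑ i ∈ J, {e : Fin 2 →₀ ℕ | ∃ w : Fin 2 → ℤ, 0 < w 0 ∧ 0 < w 1 ∧ e ∈ A i ∧
        ∀ e' ∈ A i, e' ≠ e →
          w 0 * (e 0 : ℤ) + w 1 * (e 1 : ℤ) < w 0 * (e' 0 : ℤ) + w 1 * (e' 1 : ℤ)}.ncard + 1 := by
  induction J using Finset.induction_on with
  | empty =>
    simp only [Finset.sum_empty, Finset.card_empty, add_zero, zero_add]
    refine ⟨Finset.zero_nonempty, ?_⟩
    have h := sv_ncard_le_card (0 : Finset (Fin 2 →₀ ℕ))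
    rwa [Finset.card_zero] at h
  | insert a J ha ih =>
    obtain ⟨hne, hle⟩ := ih fun i hi => hA i (Finset.mem_insert_of_mem hi)
    have haA := hA a (Finset.mem_insert_self a J)
    rw [Finset.sum_insert ha, Finset.sum_insert ha, Finset.card_insert_of_notMem ha]
    refine ⟨haA.add hne, ?_⟩
    rw [show A a + ∑ i ∈ J, A i = Finset.image₂ (· + ·) (A a) (∑ i ∈ J, A i) from rfl]
    have brick := stub_minkowskiSW (A a) (∑ i ∈ J, A i) haA hne
    omega

open scoped Pointwise in
/-- LEADER SETS ARE CHEAP: a translate of `Σ_{i∈J} A_i` has at most `Σ_{i∈J} |A_i| + 1` south-west vertices.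
[folklore] -/
theorem sv_leaders_le {ι : Type*} [DecidableEq ι] (J : Finset ι) (A : ι → Finset (Fin 2 →₀ ℕ))
    (r : Fin 2 →₀ ℕ) :
    {e : Fin 2 →₀ ℕ | ∃ w : Fin 2 → ℤ, 0 < w 0 ∧ 0 < w 1 ∧ e ∈ Finset.image₂ (· + ·) (∑ i ∈ J, A i) {r} ∧
        ∀ e' ∈ Finset.image₂ (· + ·) (∑ i ∈ J, A i) {r}, e' ≠ e →
          w 0 * (e 0 : ℤ) + w 1 * (e 1 : ℤ) < w 0 * (e' 0 : ℤ) + w 1 * (e' 1 : ℤ)}.ncard ≤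
      ∑ i ∈ J, (A i).card + 1 := by
  by_cases hA : ∀ i ∈ J, (A i).Nonempty
  · obtain ⟨hne, hle⟩ := sv_sum_le J A hA
    have brick := stub_minkowskiSW (∑ i ∈ J, A i) {r} hne (Finset.singleton_nonempty r)
    have h1 := sv_ncard_le_card ({r} : Finset (Fin 2 →₀ ℕ))
    rw [Finset.card_singleton] at h1
    have h3 := Finset.sum_le_sum (s := J) fun i _ => sv_ncard_le_card (A i)
    omega
  · have hempty : ∑ i ∈ J, A i = ∅ := by
      simp only [not_forall] at hA
      obtain ⟨i, hi, hAi⟩ := hA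
      refine Finset.eq_empty_of_forall_notMem fun b hb => hAi ?_
      obtain ⟨g, hg, -⟩ := (mem_finsetSum_iff J A b).mp hb
      exact ⟨g i, hg i hi⟩
    rw [hempty, Finset.image₂_empty_left]
    exact (sv_ncard_le_card ∅).trans (by simp)

/-! ## Leader sets of the patterns -/

open scoped Pointwise in
/-- LEADERS OF A PATTERN.  For a pattern `J` there is a finite leader set `M_J ⊆ supp D` (empty if the core part
`R_J = ∏_{i∉J} s_i − ∏_{i∉J} s'_i` vanishes, else `(Σ_{i∈J} T*_i) + (o_J, 0)` with `o_J` the least abscissa of `R_J`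
and `T*_i` the letters of `T_i` with nonzero coefficient) such that every support point seen by a piece of pattern
`J` has a leader weakly to its left on its row, and `#swVert(M_J) ≤ Σ_{i∈J} |T_i| + 1`. [folklore] -/
theorem exists_leaders {n : ℕ} (s s' : Fin n → MvPolynomial (Fin 2) ℂ) (T : Fin n → Finset (Fin 2 →₀ ℕ))
    (c : Fin n → (Fin 2 →₀ ℕ) → ℂ) (hs : ∀ i, ∀ q ∈ (s i).support, q 1 = 0)
    (hs' : ∀ i, ∀ q ∈ (s' i).support, q 1 = 0)
    (hd : ∀ (I I' : Finset (Fin n)) (κ κ' : Fin n → (Fin 2 →₀ ℕ)), (∀ i ∈ I, κ i ∈ T i) →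
      (∀ i ∈ I', κ' i ∈ T i) → ∑ i ∈ I, (κ i) 1 = ∑ i ∈ I', (κ' i) 1 → I = I' ∧ ∀ i ∈ I, κ i = κ' i)
    (J : Finset (Fin n)) :
    ∃ M : Finset (Fin 2 →₀ ℕ),
      M ⊆ ((∏ i, (s i + ∑ b ∈ T i, C (c i b) * monomial b 1)) -
          ∏ i, (s' i + ∑ b ∈ T i, C (c i b) * monomial b 1)).support ∧
      (∀ x ∈ Fintype.piFinset (fun i => Finset.insertNone (T i)),
        (Finset.univ.filter fun i => (x i).isSome) = J → ∏ i, (x i).elim 1 (c i) ≠ 0 →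
        ∀ q : Fin 2 →₀ ℕ, ∑ i, (x i).elim 0 id ≤ q →
          q - ∑ i, (x i).elim 0 id ∈
            ((∏ i, (x i).elim (s i) (fun _ => 1)) - ∏ i, (x i).elim (s' i) (fun _ => 1)).support →
          ∃ m ∈ M, m 1 = q 1 ∧ m 0 ≤ q 0) ∧
      {e : Fin 2 →₀ ℕ | ∃ w : Fin 2 → ℤ, 0 < w 0 ∧ 0 < w 1 ∧ e ∈ M ∧
        ∀ e' ∈ M, e' ≠ e →
          w 0 * (e 0 : ℤ) + w 1 * (e 1 : ℤ) < w 0 * (e' 0 : ℤ) + w 1 * (e' 1 : ℤ)}.ncard ≤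
        ∑ i ∈ J, (T i).card + 1 := by
  classical
  -- the core part of the pattern `J`
  set R : MvPolynomial (Fin 2) ℂ := (∏ i, if i ∈ J then (1 : MvPolynomial (Fin 2) ℂ) else s i) -
    ∏ i, if i ∈ J then (1 : MvPolynomial (Fin 2) ℂ) else s' i with hRdef
  have hRx : ∀ x : Fin n → Option (Fin 2 →₀ ℕ), (Finset.univ.filter fun i => (x i).isSome) = J →
      ((∏ i, (x i).elim (s i) fun _ => 1) - ∏ i, (x i).elim (s' i) fun _ => 1) = R := fun x hJ => by
    rw [hRdef, core_eq s x J hJ, core_eq s' x J hJ]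
  by_cases hR0 : R = 0
  · refine ⟨∅, Finset.empty_subset _, ?_, (sv_ncard_le_card ∅).trans (by simp)⟩
    intro x _ hJ _ q _ hq
    rw [hRx x hJ, hR0, support_zero] at hq
    exact absurd hq (Finset.notMem_empty _)
  obtain ⟨r, hr, hrmin⟩ := R.support.exists_min_image (fun q : Fin 2 →₀ ℕ => q 0)
    (MvPolynomial.support_nonempty.mpr hR0)
  -- the letters with nonzero coefficient
  obtain ⟨Tst, hmemT, hcardT⟩ : ∃ Tst : Fin n → Finset (Fin 2 →₀ ℕ),
      (∀ i b, b ∈ Tst i ↔ b ∈ T i ∧ c i b ≠ 0) ∧ ∀ i, (Tst i).card ≤ (T i).card :=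
    ⟨fun i => (T i).filter fun b => c i b ≠ 0, fun i b => Finset.mem_filter, fun i => Finset.card_filter_le _ _⟩
  refine ⟨Finset.image₂ (· + ·) (∑ i ∈ J, Tst i) {r}, ?_, ?_, ?_⟩
  · -- leaders are support points
    intro m hm
    obtain ⟨b, hb, r', hr', rfl⟩ := Finset.mem_image₂.mp hm
    rw [Finset.mem_singleton.mp hr']
    obtain ⟨g, hg, rfl⟩ := (mem_finsetSum_iff J Tst b).mp hb
    -- the piece of pattern `J` with tag letters `g`
    obtain ⟨x, hxdef⟩ : ∃ x : Fin n → Option (Fin 2 →₀ ℕ), ∀ i, x i = if i ∈ J then some (g i) else none :=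
      ⟨_, fun i => rfl⟩
    have hxX : x ∈ Fintype.piFinset fun i => Finset.insertNone (T i) := by
      refine Fintype.mem_piFinset.mpr fun i => ?_
      rw [hxdef i]
      split_ifs with hi
      exacts [Finset.some_mem_insertNone.mpr ((hmemT i (g i)).mp (hg i hi)).1, Finset.none_mem_insertNone]
    have hJx : (Finset.univ.filter fun i => (x i).isSome) = J := by
      ext i
      simp only [Finset.mem_filter, Finset.mem_univ, true_and, hxdef i]
      split_ifs with hi <;> simp [hi]
    have hcx : ∏ i, (x i).elim 1 (c i) ≠ 0 := by
      refine Finset.prod_ne_zero_iff.mpr fun i _ => ?_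
      rw [hxdef i]
      split_ifs with hi
      exacts [((hmemT i (g i)).mp (hg i hi)).2, one_ne_zero]
    have hbx : ∑ i, (x i).elim (0 : Fin 2 →₀ ℕ) id = ∑ i ∈ J, g i := by
      rw [← Fintype.sum_ite_mem J g]
      exact Finset.sum_congr rfl fun i _ => by rw [hxdef i]; split_ifs <;> rfl
    have key := add_mem_support s s' T c hs hs' hd hxX hcx (r := r) (by rw [hRx x hJx]; exact hr)
    rwa [hbx] at key
  · -- every point seen by a piece of pattern `J` has a leader weakly to its left
    intro x hx hJ hc q hle hq
    have hR1 := core_support s s' hs hs' x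
    rw [hRx x hJ] at hq hR1
    refine ⟨(∑ i, (x i).elim 0 id) + r, Finset.mem_image₂_of_mem ?_ (Finset.mem_singleton_self r), ?_, ?_⟩
    · rw [mem_finsetSum_iff]
      refine ⟨fun i => (x i).elim 0 id, fun i hi => ?_, ?_⟩
      · rw [hmemT]
        show (x i).elim 0 id ∈ T i ∧ c i ((x i).elim 0 id) ≠ 0
        have hxi := Fintype.mem_piFinset.mp hx i
        have hci := Finset.prod_ne_zero_iff.mp hc i (Finset.mem_univ i)
        rw [← hJ] at hi
        simp only [Finset.mem_filter, Finset.mem_univ, true_and] at hi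
        cases hxi' : x i with
        | none => rw [hxi'] at hi; simp at hi
        | some b => rw [hxi'] at hxi hci; exact ⟨Finset.some_mem_insertNone.mp hxi, hci⟩
      · rw [← hJ, Finset.sum_filter_of_ne]
        intro i _ hne; revert hne; cases x i <;> simp
    · have h1 := hR1 _ hq
      have h2 := hR1 r hr
      have h3 := Finsupp.le_def.mp hle 1
      simp only [Finsupp.coe_add, Finsupp.coe_tsub, Pi.add_apply, Pi.sub_apply] at h1 ⊢
      omega
    · have h1 := hrmin _ hq
      have h3 := Finsupp.le_def.mp hle 0
      simp only [Finsupp.coe_add, Finsupp.coe_tsub, Pi.add_apply, Pi.sub_apply] at h1 ⊢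
      omega
  · -- count
    exact (sv_leaders_le J Tst r).trans (Nat.add_le_add_right (Finset.sum_le_sum fun i _ => hcardT i) 1)

/-! ## The registered stub -/

/-- STUB `stub_engineTaggedCores` (registered vocabulary).  `x`-axis cores plus a shared tag part with dissociated
ordinates: `∏ (s_i + τ_i) − ∏ (s'_i + τ_i)` has at most `2^n (Σ_i |T_i| + 1)` south-west vertices. [folklore] -/
theorem stub_engineTaggedCores : ∀ (n : ℕ) (s s' : Fin n → MvPolynomial (Fin 2) ℂ) (T : Fin n → Finset (Fin 2 →₀ ℕ))
    (c : Fin n → (Fin 2 →₀ ℕ) → ℂ),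
    (∀ i, ∀ q ∈ (s i).support, q 1 = 0) → (∀ i, ∀ q ∈ (s' i).support, q 1 = 0) →
    (∀ (I I' : Finset (Fin n)) (κ κ' : Fin n → (Fin 2 →₀ ℕ)), (∀ i ∈ I, κ i ∈ T i) → (∀ i ∈ I', κ' i ∈ T i) →
      ∑ i ∈ I, (κ i) 1 = ∑ i ∈ I', (κ' i) 1 → I = I' ∧ ∀ i ∈ I, κ i = κ' i) →
    {e : Fin 2 →₀ ℕ | ∃ w : Fin 2 → ℤ, 0 < w 0 ∧ 0 < w 1 ∧
        e ∈ ((∏ i, (s i + ∑ b ∈ T i, MvPolynomial.C (c i b) * MvPolynomial.monomial b 1)) -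
              ∏ i, (s' i + ∑ b ∈ T i, MvPolynomial.C (c i b) * MvPolynomial.monomial b 1)).support ∧
        ∀ e' ∈ ((∏ i, (s i + ∑ b ∈ T i, MvPolynomial.C (c i b) * MvPolynomial.monomial b 1)) -
              ∏ i, (s' i + ∑ b ∈ T i, MvPolynomial.C (c i b) * MvPolynomial.monomial b 1)).support, e' ≠ e →
          w 0 * (e 0 : ℤ) + w 1 * (e 1 : ℤ) < w 0 * (e' 0 : ℤ) + w 1 * (e' 1 : ℤ)}.ncard
      ≤ 2 ^ n * (∑ i, (T i).card + 1) := by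
  intro n s s' T c hs hs' hd
  classical
  choose M hMS hMcov hMle using exists_leaders s s' T c hs hs' hd
  have hcov := sv_subset_iUnion _ M hMS fun e he => by
    obtain ⟨x, hx, hc, hle, hq⟩ := exists_piece s s' T c he
    obtain ⟨m, hm, h1, h0⟩ := hMcov _ x hx rfl hc e hle hq
    exact ⟨_, m, hm, h1, h0⟩
  refine (Set.ncard_le_ncard hcov ?_).trans ?_
  · exact Set.finite_iUnion fun J => (Finset.finite_toSet (M J)).subset (by rintro e ⟨w, -, -, he, -⟩; exact he)
  refine (Set.ncard_iUnion_le_of_fintype _).trans ?_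
  refine (Finset.sum_le_sum fun J _ => hMle J).trans ?_
  calc ∑ J : Finset (Fin n), (∑ i ∈ J, (T i).card + 1)
      ≤ ∑ J : Finset (Fin n), (∑ i, (T i).card + 1) := Finset.sum_le_sum fun J _ =>
        Nat.add_le_add_right (Finset.sum_le_sum_of_subset (Finset.subset_univ J)) 1
    _ = 2 ^ n * (∑ i, (T i).card + 1) := by
        rw [Finset.sum_const, smul_eq_mul, Finset.card_univ, Fintype.card_finset, Fintype.card_fin]

end Summit.ValiantsHypothesis.ValiantsHypothesis.Theorems.TwoProducts.TaggedCores
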